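import Summits.AnomalousDissipation.AnomalousDissipation.Theorems.MomentParityCubicParityLoudDiagonalClassificationExtractionReal
import Summits.AnomalousDissipation.AnomalousDissipation.Theorems.MomentParityCubicParityLoudDiagonalClassificationAssembly

/-!
# Bridge: the effective real blocks of a block-diagonal Casimir kernel are classified

Helper file for stub `stub_diagonalClassification` (S3b) of the line `farkas-split-menu` of crux
`MomentParity.CubicParityLoud`.  For a block-diagonal kernel `D` whose real quadratic form is a
Casimir of the Galerkin–Euler field on the punctured ball `S` of radius `N ≥ 3`, the real
bilinear forms on `ℝ³`
`β_k(u, w) = (σ_k + σ_{−k})(P_k u, P_k w)`, `γ_k(u, w) = (σ_k − σ_{−k})(i P_k u, P_k w)`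
(`σ_k(x, y) = Re⟪x, D k y⟫ + Re⟪y, D k x⟫`, `P_k = leraySym k`, real vectors complexified) are
symmetric, resp. antisymmetric, compressed (`P_k k = 0`), even in `k`, and satisfy the two
single-triad identities (`extraction_S`, `extraction_A`); their matrices / axial scalars therefore
satisfy the hypotheses of `assembly`, whence constants `α, β` with `β_k(u, w) = α u·w` (`w ⊥ k`)
and `γ_k(u, w) = β u·(k × w)` for all `k ∈ S`.
-/

namespace Summit.AnomalousDissipation.AnomalousDissipation.Theorems.MomentParityCubicParityLoud

open Complex Finset Matrix
open scoped InnerProductSpace ComplexConjugate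
open Literature.Analysis.FunctionSpaces Literature.Analysis.FluidPDE

set_option linter.dupNamespace false

/-- The punctured frequency ball is symmetric. [folklore] -/
theorem neg_mem_ballErase {N : ℕ} {k : Fin 3 → ℤ} (hk : k ∈ (Torus.freqBall N).erase (0 : Fin 3 → ℤ)) :
    -k ∈ (Torus.freqBall N).erase (0 : Fin 3 → ℤ) := by
  rw [Finset.mem_erase] at hk ⊢
  exact ⟨neg_ne_zero.2 hk.1, Torus.neg_mem_freqBall.2 hk.2⟩

/-- Membership in the punctured ball in integer arithmetic. [folklore] -/
theorem mem_ballErase_iff :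
    ∀ (N : ℕ) (k : Fin 3 → ℤ), k ∈ (Torus.freqBall N).erase (0 : Fin 3 → ℤ) ↔ k ≠ 0 ∧ k ⬝ᵥ k ≤ (N : ℤ) ^ 2 := by
  intro N k
  rw [Finset.mem_erase, Torus.mem_freqBall, Torus.freqNormSq]
  have e : ((k ⬝ᵥ k : ℤ) : ℝ) = ∑ i, (k i : ℝ) ^ 2 := by
    simp [dotProduct, sq]
  constructor
  · rintro ⟨h0, h⟩; exact ⟨h0, by exact_mod_cast (e ▸ h : ((k ⬝ᵥ k : ℤ) : ℝ) ≤ (N : ℝ) ^ 2)⟩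
  · rintro ⟨h0, h⟩; refine ⟨h0, ?_⟩; rw [← e]; exact_mod_cast h

/-- The Leray multiplier kills (the complexification of) its own frequency. [folklore] -/
theorem leraySym_cx_self {k : Fin 3 → ℤ} (hk : k ≠ 0) :
    Torus.leraySym k (WithLp.toLp 2 (fun i => (((fun i => ((k : Fin 3 → ℤ) i : ℝ)) i : ℝ) : ℂ)) : EuclideanSpace ℂ (Fin 3)) = 0 := by
  have hq : ((Torus.freqNormSq k : ℝ) : ℂ) ≠ 0 := by
    rw [Ne, Complex.ofReal_eq_zero, Torus.freqNormSq_eq_zero_iff]; exact hk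
  have e : (WithLp.toLp 2 (fun i => (((fun i => ((k : Fin 3 → ℤ) i : ℝ)) i : ℝ) : ℂ)) : EuclideanSpace ℂ (Fin 3)) = Torus.freqVec k := by
    ext i; simp [Torus.freqVec_apply]
  rw [e, Torus.leraySym_def, Torus.sum_mul_freqVec, div_self hq, one_smul, sub_self]

set_option maxHeartbeats 4000000 in
/-- **Bridge.**  For a block-diagonal Casimir kernel on the punctured ball of radius `N ≥ 3`, the
effective real forms `β_k`, `γ_k` (see the module docstring) are `α·(u·w)` on `w ⊥ k`, resp.
`β·(u·(k × w))`, for constants `α, β` and all `k` in the ball. [folklore] -/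
theorem bridge (N : ℕ) (hN : 3 ≤ N)
    (D : (Fin 3 → ℤ) → (EuclideanSpace ℂ (Fin 3) →ₗ[ℂ] EuclideanSpace ℂ (Fin 3)))
    (hD : (∀ c : (Fin 3 → ℤ) → EuclideanSpace ℂ (Fin 3), (Torus.IsConjSymm c ∧
        Torus.IsTransversal ((Torus.freqBall N).erase (0 : Fin 3 → ℤ)) c ∧
          ∀ k ∉ (Torus.freqBall N).erase (0 : Fin 3 → ℤ), c k = 0) →
      ∑ k ∈ ((Torus.freqBall N).erase (0 : Fin 3 → ℤ)),
        ((inner ℂ (Torus.leraySym k (Torus.convectionCoeff ((Torus.freqBall N).erase (0 : Fin 3 → ℤ)) c c k)) (D k (c k))).re +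
          (inner ℂ (c k) (D k (Torus.leraySym k (Torus.convectionCoeff ((Torus.freqBall N).erase (0 : Fin 3 → ℤ)) c c k)))).re) = 0)) :
    ∃ α β : ℝ, ∀ k ∈ (Torus.freqBall N).erase (0 : Fin 3 → ℤ),
      (∀ u w : Fin 3 → ℝ, w ⬝ᵥ (fun i => ((k : Fin 3 → ℤ) i : ℝ)) = 0 →
        (((inner ℂ (Torus.leraySym k (WithLp.toLp 2 (fun i => ((u i : ℝ) : ℂ)) : EuclideanSpace ℂ (Fin 3))) (D k (Torus.leraySym k (WithLp.toLp 2 (fun i => ((w i : ℝ) : ℂ)) : EuclideanSpace ℂ (Fin 3))))).re + (inner ℂ (Torus.leraySym k (WithLp.toLp 2 (fun i => ((w i : ℝ) : ℂ)) : EuclideanSpace ℂ (Fin 3))) (D k (Torus.leraySym k (WithLp.toLp 2 (fun i => ((u i : ℝ) : ℂ)) : EuclideanSpace ℂ (Fin 3))))).re) + ((inner ℂ (Torus.leraySym k (WithLp.toLp 2 (fun i => ((u i : ℝ) : ℂ)) : EuclideanSpace ℂ (Fin 3))) (D (-k) (Torus.leraySym k (WithLp.toLp 2 (fun i => ((w i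 : ℝ) : ℂ)) : EuclideanSpace ℂ (Fin 3))))).re + (inner ℂ (Torus.leraySym k (WithLp.toLp 2 (fun i => ((w i : ℝ) : ℂ)) : EuclideanSpace ℂ (Fin 3))) (D (-k) (Torus.leraySym k (WithLp.toLp 2 (fun i => ((u i : ℝ) : ℂ)) : EuclideanSpace ℂ (Fin 3))))).re))
          = α * (u ⬝ᵥ w)) ∧
      (∀ u w : Fin 3 → ℝ,
        (((inner ℂ (Complex.I • Torus.leraySym k (WithLp.toLp 2 (fun i => ((u i : ℝ) : ℂ)) : EuclideanSpace ℂ (Fin 3))) (D k (Torus.leraySym k (WithLp.toLp 2 (fun i => ((w i : ℝ) : ℂ)) : EuclideanSpace ℂ (Fin 3))))).re + (inner ℂ (Torus.leraySym k (WithLp.toLp 2 (fun i => ((w i : ℝ) : ℂ)) : EuclideanSpace ℂ (Fin 3))) (D k (Complex.I • Torus.leraySym k (WithLp.toLp 2 (fun i => ((u i : ℝ) : ℂ)) : EuclideanSpace ℂ (Fin 3))))).re) - ((inner ℂ (Complex.I • Torus.leraySym k (WithLp.toLp 2 (fun i => ((u i : ℝ) : ℂ)) : EuclideanSpace ℂ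 (Fin 3))) (D (-k) (Torus.leraySym k (WithLp.toLp 2 (fun i => ((w i : ℝ) : ℂ)) : EuclideanSpace ℂ (Fin 3))))).re + (inner ℂ (Torus.leraySym k (WithLp.toLp 2 (fun i => ((w i : ℝ) : ℂ)) : EuclideanSpace ℂ (Fin 3))) (D (-k) (Complex.I • Torus.leraySym k (WithLp.toLp 2 (fun i => ((u i : ℝ) : ℂ)) : EuclideanSpace ℂ (Fin 3))))).re))
          = β * (u ⬝ᵥ crossProduct (fun i => ((k : Fin 3 → ℤ) i : ℝ)) w)) := by
  set S : Finset (Fin 3 → ℤ) := (Torus.freqBall N).erase (0 : Fin 3 → ℤ) with hS_def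
  have hSsym : ∀ k ∈ S, -k ∈ S := fun k hk => neg_mem_ballErase hk
  have hmem : ∀ k : Fin 3 → ℤ, k ∈ S ↔ k ≠ 0 ∧ k ⬝ᵥ k ≤ (N : ℤ) ^ 2 := mem_ballErase_iff N
  -- the two families of real forms, kept opaque
  obtain ⟨βf, hβ⟩ : ∃ βf : (Fin 3 → ℤ) → (Fin 3 → ℝ) → (Fin 3 → ℝ) → ℝ, ∀ k u w, βf k u w =
      (((inner ℂ (Torus.leraySym k (WithLp.toLp 2 (fun i => ((u i : ℝ) : ℂ)) : EuclideanSpace ℂ (Fin 3))) (D k (Torus.leraySym k (WithLp.toLp 2 (fun i => ((w i : ℝ) : ℂ)) : EuclideanSpace ℂ (Fin 3))))).re + (inner ℂ (Torus.leraySym k (WithLp.toLp 2 (fun i => ((w i : ℝ) : ℂ)) : EuclideanSpace ℂ (Fin 3))) (D k (Torus.leraySym k (WithLp.toLp 2 (fun i => ((u i : ℝ) : ℂ)) : EuclideanSpace ℂ (Fin 3))))).re) + ((inner ℂ (Torus.leraySym k (WithLp.toLp 2 (fun i => ((u i : ℝ) : ℂ)) : EuclideanSpace ℂ (Fin 3)))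 (D (-k) (Torus.leraySym k (WithLp.toLp 2 (fun i => ((w i : ℝ) : ℂ)) : EuclideanSpace ℂ (Fin 3))))).re + (inner ℂ (Torus.leraySym k (WithLp.toLp 2 (fun i => ((w i : ℝ) : ℂ)) : EuclideanSpace ℂ (Fin 3))) (D (-k) (Torus.leraySym k (WithLp.toLp 2 (fun i => ((u i : ℝ) : ℂ)) : EuclideanSpace ℂ (Fin 3))))).re)) := ⟨_, fun _ _ _ => rfl⟩
  obtain ⟨γf, hγ⟩ : ∃ γf : (Fin 3 → ℤ) → (Fin 3 → ℝ) → (Fin 3 → ℝ) → ℝ, ∀ k u w, γf k u w =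
      (((inner ℂ (Complex.I • Torus.leraySym k (WithLp.toLp 2 (fun i => ((u i : ℝ) : ℂ)) : EuclideanSpace ℂ (Fin 3))) (D k (Torus.leraySym k (WithLp.toLp 2 (fun i => ((w i : ℝ) : ℂ)) : EuclideanSpace ℂ (Fin 3))))).re + (inner ℂ (Torus.leraySym k (WithLp.toLp 2 (fun i => ((w i : ℝ) : ℂ)) : EuclideanSpace ℂ (Fin 3))) (D k (Complex.I • Torus.leraySym k (WithLp.toLp 2 (fun i => ((u i : ℝ) : ℂ)) : EuclideanSpace ℂ (Fin 3))))).re) - ((inner ℂ (Complex.I • Torus.leraySym k (WithLp.toLp 2 (fun i => ((u i : ℝ) : ℂ)) : EuclideanSpace ℂ (Fin 3))) (D (-k) (Torus.leraySym k (WithLp.toLp 2 (fun i => ((w i : ℝ) : ℂ)) : EuclideanSpace ℂ (Fin 3))))).re + (inner ℂ (Torus.leraySym k (WithLp.toLp 2 (fun i => ((w i : ℝ) : ℂ)) : EuclideanSpace ℂ (Fin 3))) (D (-k) (Complex.I • Torus.leraySym k (WithLp.toLp 2 (fun i => ((u i : ℝ) : ℂ)) : EuclideanSpace ℂ (Fin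 3))))).re)) := ⟨_, fun _ _ _ => rfl⟩
  -- bilinearity
  have βadd₁ : ∀ k u v w, βf k (u + v) w = βf k u w + βf k v w := by
    intro k u v w; simp only [hβ, cx_add, Torus.leraySym_add, 
      map_add, 
      inner_add_left, inner_add_right
      ]; simp only [Complex.add_re
      
      
      
      ]; ring
  have βadd₂ : ∀ k u v w, βf k u (v + w) = βf k u v + βf k u w := by
    intro k u v w; simp only [hβ, cx_add, Torus.leraySym_add, 
      map_add, 
      inner_add_left, inner_add_right
      ]; simp only [Complex.add_re
      
      
      
      ]; ring
  have βsmul₁ : ∀ k (s : ℝ) u w, βf k (s • u) w = s • βf k u w := by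
    intro k s u w; simp only [hβ, cx_smul, Torus.leraySym_smul, 
      map_smul, 
      inner_smul_left, inner_smul_right
      ]; simp only [Complex.conj_ofReal, 
      Complex.mul_re, Complex.ofReal_re,
      Complex.ofReal_im, 
      zero_mul, sub_zero, 
      smul_eq_mul]; ring
  have βsmul₂ : ∀ k (s : ℝ) u w, βf k u (s • w) = s • βf k u w := by
    intro k s u w; simp only [hβ, cx_smul, Torus.leraySym_smul, 
      map_smul, 
      inner_smul_left, inner_smul_right
      ]; simp only [Complex.conj_ofReal, 
      Complex.mul_re, Complex.ofReal_re,
      Complex.ofReal_im, 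
      zero_mul, sub_zero, 
      smul_eq_mul]; ring
  have γadd₁ : ∀ k u v w, γf k (u + v) w = γf k u w + γf k v w := by
    intro k u v w; simp only [hγ, cx_add, Torus.leraySym_add, 
      map_add, map_smul, 
      inner_add_left, inner_add_right, inner_smul_left, inner_smul_right
      ]; simp only [Complex.conj_I, Complex.add_re, 
      Complex.add_im, Complex.mul_re, Complex.neg_re, 
      Complex.I_re, Complex.I_im, 
      zero_mul, zero_sub, one_mul, neg_mul, neg_neg
      ]; ring
  have γadd₂ : ∀ k u v w, γf k u (v + w) = γf k u v + γf k u w := by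
    intro k u v w; simp only [hγ, cx_add, Torus.leraySym_add, 
      map_add, map_smul, 
      inner_add_left, inner_add_right, inner_smul_left, inner_smul_right
      ]; simp only [Complex.conj_I, Complex.add_re, 
      Complex.add_im, Complex.mul_re, Complex.neg_re, 
      Complex.I_re, Complex.I_im, 
      zero_mul, zero_sub, one_mul, neg_mul, neg_neg
      ]; ring
  have γsmul₁ : ∀ k (s : ℝ) u w, γf k (s • u) w = s • γf k u w := by
    intro k s u w; simp only [hγ, cx_smul, Torus.leraySym_smul, 
      map_smul, smul_smul, 
      inner_smul_left, inner_smul_right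
      ]; simp only [map_mul, Complex.conj_ofReal, Complex.conj_I, 
      Complex.mul_re, Complex.mul_im, Complex.neg_re, Complex.ofReal_re,
      Complex.ofReal_im, Complex.I_re, Complex.I_im, 
      mul_zero, zero_mul, sub_zero, zero_sub, zero_add, one_mul, neg_mul, neg_neg, 
      smul_eq_mul]; ring
  have γsmul₂ : ∀ k (s : ℝ) u w, γf k u (s • w) = s • γf k u w := by
    intro k s u w; simp only [hγ, cx_smul, Torus.leraySym_smul, 
      map_smul, 
      inner_smul_left, inner_smul_right
      ]; simp only [Complex.conj_ofReal, Complex.conj_I, 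
      Complex.mul_re, Complex.mul_im, Complex.neg_re, Complex.ofReal_re,
      Complex.ofReal_im, Complex.I_re, Complex.I_im, 
      zero_mul, sub_zero, zero_sub, add_zero, zero_add, one_mul, neg_mul, mul_neg, neg_neg, 
      smul_eq_mul]; ring
  -- symmetry, antisymmetry, evenness, compression
  have βsymm : ∀ k u w, βf k u w = βf k w u := by
    intro k u w; simp only [hβ]; ring
  have γanti : ∀ k u w, γf k u w = -γf k w u := by
    intro k u w; simp only [hγ, 
      map_smul, 
      inner_smul_left, inner_smul_right
      ]; simp only [Complex.conj_I, 
      Complex.mul_re, Complex.neg_re, 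
      Complex.I_re, Complex.I_im, 
      zero_mul, zero_sub, one_mul, neg_mul, neg_neg
      ]; ring
  have βeven : ∀ k u w, βf (-k) u w = βf k u w := by
    intro k u w; simp only [hβ, neg_neg, Torus.leraySym_neg_freq]; ring
  have γeven : ∀ k u w, γf (-k) u w = -γf k u w := by
    intro k u w; simp only [hγ, neg_neg, Torus.leraySym_neg_freq]; ring
  have βker : ∀ k, k ≠ 0 → ∀ u, βf k u (fun i => ((k : Fin 3 → ℤ) i : ℝ)) = 0 := by
    intro k hk u; simp only [hβ, leraySym_cx_self hk, inner_zero_left, inner_zero_right, map_zero, Complex.zero_re]; ring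
  have γker₂ : ∀ k, k ≠ 0 → ∀ u, γf k u (fun i => ((k : Fin 3 → ℤ) i : ℝ)) = 0 := by
    intro k hk u; simp only [hγ, leraySym_cx_self hk, inner_zero_left, inner_zero_right, map_zero, Complex.zero_re]; ring
  -- matrices
  obtain ⟨BB, hBB⟩ : ∃ BB : (Fin 3 → ℤ) → LinearMap.BilinForm ℝ (Fin 3 → ℝ), ∀ k u w, BB k u w = βf k u w :=
    ⟨fun k => LinearMap.mk₂ ℝ (βf k) (βadd₁ k) (βsmul₁ k) (βadd₂ k) (βsmul₂ k), fun _ _ _ => rfl⟩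
  obtain ⟨GG, hGG⟩ : ∃ GG : (Fin 3 → ℤ) → LinearMap.BilinForm ℝ (Fin 3 → ℝ), ∀ k u w, GG k u w = γf k u w :=
    ⟨fun k => LinearMap.mk₂ ℝ (γf k) (γadd₁ k) (γsmul₁ k) (γadd₂ k) (γsmul₂ k), fun _ _ _ => rfl⟩
  obtain ⟨M, hM⟩ : ∃ M : (Fin 3 → ℤ) → Matrix (Fin 3) (Fin 3) ℝ, ∀ k, M k = LinearMap.BilinForm.toMatrix' (BB k) :=
    ⟨_, fun _ => rfl⟩
  obtain ⟨A, hA⟩ : ∃ A : (Fin 3 → ℤ) → Matrix (Fin 3) (Fin 3) ℝ, ∀ k, A k = LinearMap.BilinForm.toMatrix' (GG k) :=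
    ⟨_, fun _ => rfl⟩
  have hMβ : ∀ k u w, u ⬝ᵥ (M k *ᵥ w) = βf k u w := by
    intro k u w; rw [← hBB, ← Matrix.toBilin'_apply', hM, Matrix.toBilin'_toMatrix']
  have hAγ : ∀ k u w, u ⬝ᵥ (A k *ᵥ w) = γf k u w := by
    intro k u w; rw [← hGG, ← Matrix.toBilin'_apply', hA, Matrix.toBilin'_toMatrix']
  have hsymm : ∀ k ∈ S, (M k).IsSymm := by
    intro k _; refine Matrix.IsSymm.ext fun i j => ?_
    rw [hM, LinearMap.BilinForm.toMatrix'_apply, LinearMap.BilinForm.toMatrix'_apply, hBB, hBB, βsymm]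
  have mulVec_eq_zero : ∀ (X : Matrix (Fin 3) (Fin 3) ℝ) (v : Fin 3 → ℝ), (∀ u, u ⬝ᵥ (X *ᵥ v) = 0) → X *ᵥ v = 0 := by
    intro X v h; ext i
    have := h (Pi.single i 1)
    rwa [single_dotProduct, one_mul] at this
  have hker : ∀ k ∈ S, M k *ᵥ (fun i => ((k : Fin 3 → ℤ) i : ℝ)) = 0 := by
    intro k hk
    exact mulVec_eq_zero _ _ fun u => by rw [hMβ]; exact βker k ((hmem k).1 hk).1 u
  have hMeven : ∀ k ∈ S, M (-k) = M k := by
    intro k _; ext i j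
    rw [hM, hM, LinearMap.BilinForm.toMatrix'_apply, LinearMap.BilinForm.toMatrix'_apply, hBB, hBB, βeven]
  -- axial scalars of the antisymmetric blocks
  have hAanti : ∀ k, (A k)ᵀ = -(A k) := by
    intro k; ext i j
    rw [Matrix.transpose_apply, Matrix.neg_apply, hA, LinearMap.BilinForm.toMatrix'_apply,
      LinearMap.BilinForm.toMatrix'_apply, hGG, hGG, γanti]
  have hAker : ∀ k ∈ S, A k *ᵥ (fun i => ((k : Fin 3 → ℤ) i : ℝ)) = 0 := by
    intro k hk
    exact mulVec_eq_zero _ _ fun u => by rw [hAγ]; exact γker₂ k ((hmem k).1 hk).1 u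
  have castne : ∀ k : Fin 3 → ℤ, k ≠ 0 → (fun i => ((k : Fin 3 → ℤ) i : ℝ)) ≠ 0 := by
    intro k hk h; apply hk; ext i
    have := congrFun h i
    simp only [Pi.zero_apply, Int.cast_eq_zero] at this
    rw [Pi.zero_apply]; exact this
  have hlam_ex : ∀ k, ∃ lam : ℝ, k ∈ S → ∀ u w, γf k u w = lam * (u ⬝ᵥ crossProduct (fun i => ((k : Fin 3 → ℤ) i : ℝ)) w) := by
    intro k
    by_cases hk : k ∈ S
    · obtain ⟨lam, hlam⟩ := antisymm_rep (A k) _ (castne k ((hmem k).1 hk).1) (hAanti k) (hAker k hk)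
      exact ⟨lam, fun _ u w => by rw [← hAγ, hlam]⟩
    · exact ⟨0, fun h => (hk h).elim⟩
  choose lam hlam using hlam_ex
  -- evenness of the axial scalars
  have hLeven : ∀ k ∈ S, lam (-k) = lam k := by
    intro k hk
    have hk0 : k ≠ 0 := ((hmem k).1 hk).1
    have key : ∀ u w : Fin 3 → ℝ, (lam (-k) - lam k) * (u ⬝ᵥ crossProduct (fun i => ((k : Fin 3 → ℤ) i : ℝ)) w) = 0 := by
      intro u w
      have h1 := hlam (-k) (hSsym k hk) u w
      have h2 := hlam k hk u w
      have e : (fun i => (((-k) : Fin 3 → ℤ) i : ℝ)) = -(fun i => ((k : Fin 3 → ℤ) i : ℝ)) := by ext i; simp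
      rw [γeven, h2, e, LinearMap.map_neg₂, dotProduct_neg] at h1
      linear_combination h1
    -- a test pair with `u ⬝ (k × w) ≠ 0`
    have hex : ∃ w : Fin 3 → ℝ, crossProduct (fun i => ((k : Fin 3 → ℤ) i : ℝ)) w ≠ 0 := by
      by_contra hno
      push Not at hno
      apply castne k hk0
      have h0 := hno ![1, 0, 0]
      have h1 := hno ![0, 1, 0]
      rw [cross_apply] at h0 h1
      simp only [cons_val_zero, cons_val_one, cons_val_two, head_cons, tail_cons, mul_zero, mul_one,
        zero_sub, sub_zero, Matrix.cons_eq_zero_iff, Matrix.zero_empty, neg_eq_zero, and_true, true_and] at h0 h1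
      ext i; fin_cases i
      · exact h1.2
      · exact h0.2
      · exact h0.1
    obtain ⟨w, hw⟩ := hex
    have hne : crossProduct (fun i => ((k : Fin 3 → ℤ) i : ℝ)) w ⬝ᵥ crossProduct (fun i => ((k : Fin 3 → ℤ) i : ℝ)) w ≠ 0 :=
      fun h0 => hw (dotProduct_self_eq_zero.1 h0)
    have := key (crossProduct (fun i => ((k : Fin 3 → ℤ) i : ℝ)) w) w
    exact sub_eq_zero.1 ((mul_eq_zero.1 this).resolve_right hne)
  -- the two triad identities
  have hSid : ∀ a ∈ S, ∀ b ∈ S, ∀ c ∈ S, a + b = c → crossProduct a b ≠ 0 →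
      ∀ ua ub uc : Fin 3 → ℝ, ua ⬝ᵥ (fun i => (a i : ℝ)) = 0 → ub ⬝ᵥ (fun i => (b i : ℝ)) = 0 →
        uc ⬝ᵥ (fun i => (c i : ℝ)) = 0 →
        ((uc ⬝ᵥ fun i => (b i : ℝ)) • ub - (ub ⬝ᵥ fun i => (a i : ℝ)) • uc) ⬝ᵥ (M a *ᵥ ua) +
        ((uc ⬝ᵥ fun i => (a i : ℝ)) • ua - (ua ⬝ᵥ fun i => (b i : ℝ)) • uc) ⬝ᵥ (M b *ᵥ ub) +
        ((ua ⬝ᵥ fun i => (b i : ℝ)) • ub + (ub ⬝ᵥ fun i => (a i : ℝ)) • ua) ⬝ᵥ (M c *ᵥ uc) = 0 := by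
    intro a ha b hb c hc habc hab ua ub uc hua hub huc
    rw [hMβ, hMβ, hMβ, hβ, hβ, hβ]
    linear_combination extraction_S S D hSsym hD a b c ha hb hc habc hab ua ub uc hua hub huc
  have hAid : ∀ a ∈ S, ∀ b ∈ S, ∀ c ∈ S, a + b = c → crossProduct a b ≠ 0 →
      ∀ ua ub uc : Fin 3 → ℝ, ua ⬝ᵥ (fun i => (a i : ℝ)) = 0 → ub ⬝ᵥ (fun i => (b i : ℝ)) = 0 →
        uc ⬝ᵥ (fun i => (c i : ℝ)) = 0 →
        lam a * (((uc ⬝ᵥ fun i => (b i : ℝ)) • ub - (ub ⬝ᵥ fun i => (a i : ℝ)) • uc) ⬝ᵥ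
            crossProduct (fun i => (a i : ℝ)) ua) +
        lam b * (((uc ⬝ᵥ fun i => (a i : ℝ)) • ua - (ua ⬝ᵥ fun i => (b i : ℝ)) • uc) ⬝ᵥ
            crossProduct (fun i => (b i : ℝ)) ub) -
        lam c * (((ua ⬝ᵥ fun i => (b i : ℝ)) • ub + (ub ⬝ᵥ fun i => (a i : ℝ)) • ua) ⬝ᵥ
            crossProduct (fun i => (c i : ℝ)) uc) = 0 := by
    intro a ha b hb c hc habc hab ua ub uc hua hub huc
    rw [← hlam a ha, ← hlam b hb, ← hlam c hc, hγ, hγ, hγ]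
    linear_combination extraction_A S D hSsym hD a b c ha hb hc habc hab ua ub uc hua hub huc
  -- assemble
  obtain ⟨α, β, hαβ⟩ := assembly N S hN hmem M lam hsymm hker hMeven hLeven hSid hAid
  refine ⟨α, β, fun k hk => ⟨fun u w hw => ?_, fun u w => ?_⟩⟩
  · rw [← hβ, ← hMβ]; exact (hαβ k hk).1 u w hw
  · rw [← hγ, hlam k hk, (hαβ k hk).2]

end Summit.AnomalousDissipation.AnomalousDissipation.Theorems.MomentParityCubicParityLoud
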